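import Summits.AtomisticToContinuum.BoseEinsteinCondensation.Theorems.BECCutLineWeakDisorderGroundStateRigidityStubParkingTwoBAux
import HarnessLib

/-!
# Crux `GroundStateRigidity` (stmt-AtomisticToContinuum-9072), line `Sketch`:
# the registered stub `stub_parkingTwoB`

Supports (does not close) stmt-AtomisticToContinuum-9072; registered stub `stub_parkingTwoB`
(Stub D) of line Sketch (skeleton v9). **Parking lemma.** There is an absolute `c₁ > 0`
(here `c₁ = 2⁻¹⁵`) such that for `N b³ ≤ c₁ L³` any two configurations of the free region
`F_b(N, L) = {X ∈ Λ_L^N : |xᵢ - xⱼ| > b ∀ i ≠ j}` all of whose pairs are `> 2b` apart are joined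
by a continuous path in `F_b(N, L)` (with labels).

## Proof (explicit piecewise-linear construction; no obstacle routing)

For `N = 0` there is nothing to do. For `N ≥ 1` the hypothesis forces `L ≥ 32 b`; put
`P = ⌊L/(4b) - 1⌋` (so `4b(P+1) ≤ L < 4b(P+2)`), `A = ⌊L/(8b) - 1⌋`, and note `P²A ≥ N`
(`ParkingTwoB.numerology`). Every such `X` is joined to ONE canonical configuration
`P₀ = (spot i)_i` (label `i` at height `L/2 + 6b + 4b⌊⌊i/P⌋/P⌋`, horizontal position
`(4b(⌊i/P⌋ mod P + 1), 4b(i mod P + 1))`), whence `X ⇝ P₀ ⇝ Y`: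

* Step 0 (`ParkingTwoB.joinedIn_smul`): the homothety `t ↦ (1 - t/2) X` ends at `X/2`, all of
  whose coordinates are `< L/2`, keeping all pairs `> b` (they start `> 2b`).
* Parking (`ParkingTwoB.park_one`, `ParkingTwoB.park_all`): repeatedly take the HIGHEST unparked
  particle `i` (largest first coordinate) and move it by four axis-parallel segments — straight
  up to the transfer level `H = L/2 + 3b` (distances to the lower unparked particles only grow,
  parked ones sit at heights `≥ L/2 + 6b`); horizontally at level `H` to the elevator shaft of
  its column (offset `2b` in coordinate `1`; vertical gap `≥ 3b` to everybody); up the shaft to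
  its level (horizontal gap `≥ 2b` to every spot, vertical gap `≥ 3b` to the unparked); and `2b`
  across into its spot (the other spots on that level and row are `≥ 2b` away by mixed-radix
  injectivity). Each move is `ParkingTwoB.joinedIn_update`. After `N` steps the configuration
  is `P₀`, independently of `X`.
-/

noncomputable section

open MeasureTheory Filter Set Metric
open scoped ENNReal NNReal Topology

namespace Summit.AtomisticToContinuum.BoseEinsteinCondensation.Theorems.GroundStateRigidity

open Literature.MathematicalPhysics.QuantumManyBody.BoseGas

/-- Local notation: the free region `F_b(N, L) = {Z ∈ Λ_L^N : |zᵢ - zⱼ| > b ∀ i ≠ j}` of `N`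
labelled hard spheres in the open cube (the set-builder of the skeleton, not a definition). -/
local notation3 "Free(" N ", " L ", " b ")" =>
  {Z : Config N | Z ∈ boxN N L ∧ ∀ i j : Fin N, i ≠ j → b < dist (Z i) (Z j)}

/-- Local notation: the parking spot of label value `n` for `P` columns per horizontal direction —
height `L/2 + 6b + 4b⌊⌊n/P⌋/P⌋`, horizontal coordinates `4b(⌊n/P⌋ mod P + 1)` and
`4b(n mod P + 1)` (an explicit point of `ℝ³`, not a definition; as in the `Aux` file). -/
local notation3 "spot(" L ", " b ", " P ", " n ")" =>
  (!₂[L / 2 + 6 * b + 4 * b * ((n / P / P : ℕ) : ℝ), 4 * b * (((n / P % P : ℕ) : ℝ) + 1),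
    4 * b * (((n % P : ℕ) : ℝ) + 1)] : Space)

namespace ParkingTwoB

variable {N : ℕ}

/-- **Parking one particle.** In a configuration `Z` of the free region in which particle `i`
has height `< L/2` and every other particle is either not higher than `i` or parked at its spot,
particle `i` is moved to its spot inside the free region by four axis-parallel segments (up to the
transfer level `L/2 + 3b`, across to the shaft of its column, up the shaft, into the spot).
[folklore] -/
theorem park_one {L b : ℝ} {P A : ℕ} (hb : 0 < b) (hP : 4 * b * ((P : ℝ) + 1) ≤ L)
    (hA : 8 * b * ((A : ℝ) + 1) ≤ L) (hP0 : 0 < P) (hN : N ≤ P * P * A) {Z : Config N}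
    {i : Fin N} (hF : Z ∈ Free(N, L, b)) (hi : Z i 0 < L / 2)
    (hj : ∀ j, j ≠ i → Z j 0 ≤ Z i 0 ∨ Z j = spot(L, b, P, (j : ℕ))) :
    JoinedIn Free(N, L, b) Z (Function.update Z i spot(L, b, P, (i : ℕ))) := by
  -- numerology and the bounds of the spots
  have hA0 : (0 : ℝ) ≤ A := Nat.cast_nonneg A
  have hL8 : 8 * b ≤ L := by nlinarith
  have hni : (i : ℕ) < P * P * A := lt_of_lt_of_le i.isLt hN
  have hspot : ∀ j : Fin N, L / 2 + 6 * b ≤ spot(L, b, P, (j : ℕ)) 0 := fun j =>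
    (spot_bounds hb hP hA hP0 (lt_of_lt_of_le j.isLt hN)).1
  obtain ⟨hi0, hi0', hi1, hi1', hi2, hi2'⟩ := spot_bounds hb hP hA hP0 hni
  have hSbox : spot(L, b, P, (i : ℕ)) ∈ box L := spot_mem_box hb hP hA hP0 hni
  have hbox : ∀ j, Z j ∈ box L := hF.1
  have hZi := mem_box_iff.1 (hbox i)
  have hpair : ∀ j, j ≠ i → b < dist (Z i) (Z j) := fun j hji => hF.2 i j (Ne.symm hji)
  -- the transfer level and the way-points
  set H : ℝ := L / 2 + 3 * b with hH
  have hH0 : 0 < H := by linarith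
  have hHL : H < L := by linarith
  set S₀ : Space := spot(L, b, P, (i : ℕ)) with hS₀
  clear_value S₀
  have hS0 : S₀ 0 = spot(L, b, P, (i : ℕ)) 0 := by rw [hS₀]
  have hS1 : S₀ 1 = spot(L, b, P, (i : ℕ)) 1 := by rw [hS₀]
  have hS2 : S₀ 2 = spot(L, b, P, (i : ℕ)) 2 := by rw [hS₀]
  set p₁ : Space := !₂[H, Z i 1, Z i 2] with hp₁
  set p₂ : Space := !₂[H, S₀ 1 + 2 * b, S₀ 2] with hp₂
  set p₃ : Space := !₂[S₀ 0, S₀ 1 + 2 * b, S₀ 2] with hp₃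
  have hp₁box : p₁ ∈ box L := mem_box_iff.2 ⟨⟨hH0, hHL⟩, hZi.2.1, hZi.2.2⟩
  have hp₂box : p₂ ∈ box L := by
    refine mem_box_iff.2 ⟨⟨hH0, hHL⟩, ?_, ?_⟩
    · rw [hp₂, mk_apply_one]
      exact ⟨by linarith, by linarith⟩
    · rw [hp₂, mk_apply_two]
      exact ⟨by linarith, by linarith⟩
  have hp₃box : p₃ ∈ box L := by
    refine mem_box_iff.2 ⟨?_, ?_, ?_⟩
    · rw [hp₃, mk_apply_zero]
      exact ⟨by linarith, by linarith⟩
    · rw [hp₃, mk_apply_one]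
      exact ⟨by linarith, by linarith⟩
    · rw [hp₃, mk_apply_two]
      exact ⟨by linarith, by linarith⟩
  -- move 1: straight up to the transfer level
  have J1 : JoinedIn Free(N, L, b) (Function.update Z i (Z i)) (Function.update Z i p₁) := by
    refine joinedIn_update (by rwa [Function.update_eq_self]) hp₁box fun t ht j hji => ?_
    have hm1 : (Z i + t • (p₁ - Z i)) 1 = Z i 1 := by rw [segment_apply, hp₁, mk_apply_one]; ring
    have hm2 : (Z i + t • (p₁ - Z i)) 2 = Z i 2 := by rw [segment_apply, hp₁, mk_apply_two]; ring
    have hle : Z i 0 ≤ p₁ 0 := by rw [hp₁, mk_apply_zero]; linarith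
    have hm0 := segment_apply_mem_Icc ht hle
    have hp₁0 : p₁ 0 = H := rfl
    rcases hj j hji with hlow | hpark
    · exact (hpair j hji).trans_le (dist_le_dist_of_lift hm1 hm2 hlow hm0.1)
    · rw [hpark]
      refine lt_dist_of_lt_abs_sub 0 (lt_abs.2 (Or.inr ?_))
      have h1 := hm0.2
      have h2 := hspot j
      rw [hp₁0] at h1
      linarith
  -- move 2: across, at the transfer level, to the shaft of the column of `i`
  have J2 : JoinedIn Free(N, L, b) (Function.update Z i p₁) (Function.update Z i p₂) := by
    refine joinedIn_update J1.target_mem hp₂box fun t ht j hji => ?_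
    have hm0 : (p₁ + t • (p₂ - p₁)) 0 = H := by
      rw [segment_apply, hp₁, hp₂, mk_apply_zero, mk_apply_zero]; ring
    refine lt_dist_of_lt_abs_sub 0 ?_
    rw [hm0]
    rcases hj j hji with hlow | hpark
    · exact lt_abs.2 (Or.inl (by linarith))
    · rw [hpark, mk_apply_zero]
      have h2 := hspot j
      rw [mk_apply_zero] at h2
      exact lt_abs.2 (Or.inr (by linarith))
  -- move 3: up the shaft to the level of the spot of `i`
  have J3 : JoinedIn Free(N, L, b) (Function.update Z i p₂) (Function.update Z i p₃) := by
    refine joinedIn_update J2.target_mem hp₃box fun t ht j hji => ?_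
    have hm1 : (p₂ + t • (p₃ - p₂)) 1 = S₀ 1 + 2 * b := by
      rw [segment_apply, hp₂, hp₃, mk_apply_one, mk_apply_one]; ring
    rcases hj j hji with hlow | hpark
    · have hle : p₂ 0 ≤ p₃ 0 := by rw [hp₂, hp₃, mk_apply_zero, mk_apply_zero]; linarith
      have hm0 := (segment_apply_mem_Icc ht hle).1
      have hp₂0 : p₂ 0 = H := rfl
      rw [hp₂0] at hm0
      exact lt_dist_of_lt_abs_sub 0 (lt_abs.2 (Or.inl (by linarith)))
    · rw [hpark]
      rw [hS1] at hm1
      exact lt_dist_spot_of_shaft hb i j hm1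
  -- move 4: from the shaft into the spot
  have J4 : JoinedIn Free(N, L, b) (Function.update Z i p₃) (Function.update Z i S₀) := by
    refine joinedIn_update J3.target_mem hSbox fun t ht j hji => ?_
    have hm0 : (p₃ + t • (S₀ - p₃)) 0 = S₀ 0 := by
      rw [segment_apply, hp₃, mk_apply_zero]; ring
    have hm2 : (p₃ + t • (S₀ - p₃)) 2 = S₀ 2 := by
      rw [segment_apply, hp₃, mk_apply_two]; ring
    have hm1 : (p₃ + t • (S₀ - p₃)) 1 = S₀ 1 + 2 * b * (1 - t) := by
      rw [segment_apply, hp₃, mk_apply_one]; ring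
    rcases hj j hji with hlow | hpark
    · refine lt_dist_of_lt_abs_sub 0 (lt_abs.2 (Or.inl ?_))
      rw [hm0]
      linarith
    · rw [hpark]
      have hij : (i : ℕ) ≠ j := fun h => hji (Fin.ext h).symm
      rw [hS1] at hm1
      have hs0 : 0 ≤ 2 * b * (1 - t) := mul_nonneg (by linarith) (by linarith [ht.2])
      have hs1 : 2 * b * (1 - t) ≤ 2 * b := by nlinarith [mul_nonneg hb.le ht.1]
      exact lt_dist_spot_of_ne hb hij (hm0.trans hS0) (hm2.trans hS2) hs0 hs1 hm1
  rw [Function.update_eq_self] at J1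
  exact ((J1.trans J2).trans J3).trans J4

/-- **Parking everybody.** Let all heights of `W` be `< L/2`. A configuration `Z` of the free
region whose labels in `U` ("unparked") sit at their `W`-positions and whose other labels sit at
their spots is joined inside the free region to the canonical configuration `(spot i)_i`
(induction on `|U|`, parking the highest unparked particle with `park_one`). [folklore] -/
theorem park_all {L b : ℝ} {P A : ℕ} (hb : 0 < b) (hP : 4 * b * ((P : ℝ) + 1) ≤ L)
    (hA : 8 * b * ((A : ℝ) + 1) ≤ L) (hP0 : 0 < P) (hN : N ≤ P * P * A) {W : Config N}
    (hW : ∀ j, W j 0 < L / 2) :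
    ∀ (n : ℕ) (U : Finset (Fin N)) (Z : Config N), U.card = n → (∀ j ∈ U, Z j = W j) →
      (∀ j, j ∉ U → Z j = spot(L, b, P, (j : ℕ))) → Z ∈ Free(N, L, b) →
      JoinedIn Free(N, L, b) Z (fun j : Fin N => spot(L, b, P, (j : ℕ))) := by
  intro n
  induction n with
  | zero =>
    intro U Z hU _ hout hFZ
    rw [Finset.card_eq_zero] at hU
    subst hU
    have hZ : Z = fun j : Fin N => spot(L, b, P, (j : ℕ)) :=
      funext fun j => hout j (Finset.notMem_empty j)
    rw [← hZ]
    exact JoinedIn.refl hFZ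
  | succ n ih =>
    intro U Z hU hin hout hFZ
    have hne : U.Nonempty := by rw [← Finset.card_pos, hU]; exact Nat.succ_pos n
    obtain ⟨i, hi, hmax⟩ := Finset.exists_max_image U (fun j => W j 0) hne
    have hZi : Z i = W i := hin i hi
    have hlt : Z i 0 < L / 2 := by rw [hZi]; exact hW i
    have hj : ∀ j, j ≠ i → Z j 0 ≤ Z i 0 ∨ Z j = spot(L, b, P, (j : ℕ)) := by
      intro j _
      by_cases hjU : j ∈ U
      · left
        rw [hZi, hin j hjU]
        exact hmax j hjU
      · exact Or.inr (hout j hjU)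
    have J1 := park_one hb hP hA hP0 hN hFZ hlt hj
    have hcard : (U.erase i).card = n := by rw [Finset.card_erase_of_mem hi, hU]; rfl
    refine J1.trans (ih (U.erase i) _ hcard (fun j hj' => ?_) (fun j hj' => ?_) J1.target_mem)
    · obtain ⟨hji, hjU⟩ := Finset.mem_erase.1 hj'
      rw [Function.update_of_ne hji]
      exact hin j hjU
    · by_cases hji : j = i
      · subst hji
        rw [Function.update_self]
      · rw [Function.update_of_ne hji]
        exact hout j fun hjU => hj' (Finset.mem_erase.2 ⟨hji, hjU⟩)

/-- **Every well-separated dilute configuration is joined to the canonical one.** With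
`4b(P+1) ≤ L`, `8b(A+1) ≤ L`, `0 < P`, `N ≤ P²A`: a configuration of the box with all pairs `> 2b`
is joined inside the free region `F_b(N, L)` to `(spot i)_i` (compress by `1/2`, then park
everybody). [folklore] -/
theorem joinedIn_spot {L b : ℝ} {P A : ℕ} (hb : 0 < b) (hP : 4 * b * ((P : ℝ) + 1) ≤ L)
    (hA : 8 * b * ((A : ℝ) + 1) ≤ L) (hP0 : 0 < P) (hN : N ≤ P * P * A) {X : Config N}
    (hXbox : X ∈ boxN N L) (hX2 : ∀ i j : Fin N, i ≠ j → 2 * b < dist (X i) (X j)) :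
    JoinedIn Free(N, L, b) X (fun j : Fin N => spot(L, b, P, (j : ℕ))) := by
  have J0 := joinedIn_smul (b := b) hXbox hX2
  have hbox : ∀ i k, X i k ∈ Ioo 0 L := hXbox
  have hW : ∀ j, ((1 / 2 : ℝ) • X) j 0 < L / 2 := by
    intro j
    have h := (hbox j 0).2
    simp only [Pi.smul_apply, PiLp.smul_apply, smul_eq_mul]
    linarith
  exact J0.trans (park_all hb hP hA hP0 hN hW _ Finset.univ ((1 / 2 : ℝ) • X) rfl
    (fun j _ => rfl) (fun j hj => absurd (Finset.mem_univ j) hj) J0.target_mem)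

/-! ### Numerology: the choice of `P`, `A` and the dilution constant -/

/-- `⌊L/c - 1⌋` cells of size `c` fit with a margin: `c(⌊L/c - 1⌋ + 1) ≤ L < c(⌊L/c - 1⌋ + 2)`
(for `L ≥ 2c > 0`). [folklore] -/
theorem floor_spec {L c : ℝ} (hc : 0 < c) (hL : 2 * c ≤ L) :
    c * ((⌊L / c - 1⌋₊ : ℝ) + 1) ≤ L ∧ L < c * ((⌊L / c - 1⌋₊ : ℝ) + 2) := by
  have hLc : 2 ≤ L / c := by rw [le_div_iff₀ hc]; linarith
  have h0 : 0 ≤ L / c - 1 := by linarith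
  have h1 := Nat.floor_le h0
  have h2 := Nat.lt_floor_add_one (L / c - 1)
  have hmul : c * (L / c) = L := mul_div_cancel₀ L hc.ne'
  constructor
  · calc c * ((⌊L / c - 1⌋₊ : ℝ) + 1) ≤ c * (L / c) :=
          mul_le_mul_of_nonneg_left (by linarith) hc.le
      _ = L := hmul
  · calc L = c * (L / c) := hmul.symm
      _ < c * ((⌊L / c - 1⌋₊ : ℝ) + 2) := mul_lt_mul_of_pos_left (by linarith) hc

/-- **Dilution numerology.** If `1 ≤ N` and `N b³ ≤ 2⁻¹⁵ L³` then (`L ≥ 32 b` and) with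
`P = ⌊L/(4b) - 1⌋`, `A = ⌊L/(8b) - 1⌋` one has `4b(P+1) ≤ L`, `8b(A+1) ≤ L`, `0 < P` and
`N ≤ P²A`. [folklore] -/
theorem numerology {N : ℕ} {L b : ℝ} (hb : 0 < b) (hN1 : 1 ≤ N)
    (hNL : (N : ℝ) * b ^ 3 ≤ 1 / 32768 * L ^ 3) :
    4 * b * ((⌊L / (4 * b) - 1⌋₊ : ℝ) + 1) ≤ L ∧ 8 * b * ((⌊L / (8 * b) - 1⌋₊ : ℝ) + 1) ≤ L ∧
      0 < ⌊L / (4 * b) - 1⌋₊ ∧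
      N ≤ ⌊L / (4 * b) - 1⌋₊ * ⌊L / (4 * b) - 1⌋₊ * ⌊L / (8 * b) - 1⌋₊ := by
  have h1 : (1 : ℝ) ≤ N := by exact_mod_cast hN1
  have hb3 : 0 < b ^ 3 := by positivity
  have h32 : (32 * b) ^ 3 ≤ L ^ 3 := by nlinarith
  have hL : 32 * b ≤ L := (Odd.strictMono_pow (by decide : Odd 3)).le_iff_le.1 h32
  obtain ⟨hP, hP'⟩ := floor_spec (c := 4 * b) (L := L) (by linarith) (by linarith)
  obtain ⟨hA, hA'⟩ := floor_spec (c := 8 * b) (L := L) (by linarith) (by linarith)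
  set P := ⌊L / (4 * b) - 1⌋₊
  set A := ⌊L / (8 * b) - 1⌋₊
  have hL0 : 0 < L := by linarith
  have hP8 : L < 8 * b * P := by linarith
  have hA16 : L < 16 * b * A := by linarith
  have hP0' : (0 : ℝ) < P := by nlinarith
  have hP0 : 0 < P := by exact_mod_cast hP0'
  refine ⟨hP, hA, hP0, ?_⟩
  have hLL : L * L < 8 * b * P * (8 * b * P) := mul_lt_mul'' hP8 hP8 hL0.le hL0.le
  have hLLL : L * L * L < 8 * b * P * (8 * b * P) * (16 * b * A) :=
    mul_lt_mul'' hLL hA16 (by positivity) hL0.le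
  have hN0 : (0 : ℝ) ≤ N * b ^ 3 := by positivity
  have key : 1024 * b ^ 3 * (N : ℝ) < 1024 * b ^ 3 * ((P : ℝ) * P * A) := by nlinarith
  have hlt : (N : ℝ) < (P : ℝ) * P * A := lt_of_mul_lt_mul_left key (by positivity)
  exact_mod_cast hlt.le

end ParkingTwoB

open ParkingTwoB in
/-- **Stub D — parking lemma: dilute well-separated configurations are joined.** There is an
absolute `c₁ > 0` (here `2⁻¹⁵`) such that for `N b³ ≤ c₁ L³` any two configurations of the free
region `F_b(N, L) = {X ∈ Λ_L^N : |xᵢ − xⱼ| > b ∀ i ≠ j}` all of whose pair distances exceed `2b`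
are joined by a continuous path in `F_b(N, L)` (with labels): both are joined to the canonical
parked configuration `(spot i)_i` by a uniform compression followed by parking the particles one at
a time, highest first, along axis-parallel segments (`ParkingTwoB.joinedIn_spot`). [folklore] -/
theorem stub_parkingTwoB :
    ∃ c₁ : ℝ, 0 < c₁ ∧ ∀ (N : ℕ) (L b : ℝ), 0 < b → (N : ℝ) * b ^ 3 ≤ c₁ * L ^ 3 →
      ∀ X ∈ {Z : Config N | Z ∈ boxN N L ∧ ∀ i j : Fin N, i ≠ j → b < dist (Z i) (Z j)},
      ∀ Y ∈ {Z : Config N | Z ∈ boxN N L ∧ ∀ i j : Fin N, i ≠ j → b < dist (Z i) (Z j)},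
        (∀ i j : Fin N, i ≠ j → 2 * b < dist (X i) (X j)) →
        (∀ i j : Fin N, i ≠ j → 2 * b < dist (Y i) (Y j)) →
        JoinedIn {Z : Config N | Z ∈ boxN N L ∧ ∀ i j : Fin N, i ≠ j → b < dist (Z i) (Z j)} X Y := by
  refine ⟨1 / 32768, by norm_num, ?_⟩
  intro N L b hb hNL X hX Y hY hX2 hY2
  rcases Nat.eq_zero_or_pos N with hN0 | hNpos
  · subst hN0
    have hXY : X = Y := funext fun i => Fin.elim0 i
    subst hXY
    exact JoinedIn.refl hX
  · obtain ⟨hP, hA, hP0, hcap⟩ := numerology hb hNpos hNL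
    have JX := joinedIn_spot hb hP hA hP0 hcap hX.1 hX2
    have JY := joinedIn_spot hb hP hA hP0 hcap hY.1 hY2
    exact JX.trans JY.symm

end Summit.AtomisticToContinuum.BoseEinsteinCondensation.Theorems.GroundStateRigidity

end
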